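import Literature.NumberTheory.Automorphic.OrbitalMeasureFamilyOfTorusDatum     -- ★ (W4a): `exists_orbitalMeasureFamily_isQuotientOf`, pull-back lemmas, `IsQuotientOf.atPoint_transport_eq_quotientMeasure_of_pullback`
import Literature.NumberTheory.Automorphic.OrbitalIntegralCentralTransport       -- ★ `quotientMeasure_centralizer_univ_mul_eq` (one-point orbit spaces of central elements)
import Literature.NumberTheory.Automorphic.OrbitalMeasureCentralMass              -- ★ `quotientOut_conjClassesMk_eq_of_forall_comm` (brings ★ `centralizer_eq_top_of_forall_comm`)
import Literature.NumberTheory.Automorphic.UnitaryGroupOfLocalTorusMeasure       -- ★ `isInvInvariant_of_isMulRightInvariant_of_isClosed`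
import Literature.NumberTheory.Automorphic.ArchLocalRelabelTransport             -- ★ `isMulRightInvariant_map_continuousMulEquiv`
import HarnessLib

/-!
# The Weil-form orbital measure family of a COHERENT torus datum read through a bicontinuous isomorphism, with probability one-point orbit spaces at the centre
# («(W4b) THE SINGULAR WITNESS ON A CARRIER», generic; Rogawski 1990 §1.7 «compatible measures», §4.3 (4.3.1), Prop. 10.1.2 (b); Deitmar–Echterhoff Thm. 1.5.3)

Topic `NumberTheory/Automorphic`; namespace `Literature.NumberTheory.Automorphic` (generic: two locally compact second countable Hausdorff groups `B`, `A` and a bicontinuous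
`ψ : B ≃* A`).  THEOREMS ONLY (no `def`, no instance, no notation, no axiom, no named fact, no `sorry`).  Cell `pub/hodgecm-mathlib`, ENGINE T1 (crux H413 =
`stmt-HodgeConjecture-24833`); the (ST-∞) witness road, brick (W4b) (F0P3a-p07 (g9); LEAD F0P3a-plan (g10) lane T9-8 (G)): the generic core of «the arch singular witness on
`G′_∞ = U(H′)(L ⊗ ℝ)`» — instantiated per carrier by (W4c) with `ψ :=` the (T-d) congruence onto the diagonal carrier, `T :=` F0P3-p03 (g10)'s (W3-all) coherent pinned torus datum,
`P :=` its wall saturation `Pall`.  Count-neutral; HONEST LABEL: HC_CM is proved only modulo the printed citations until rung 0 closes; nothing here bears on a summit statement.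

WHAT.  Data: `ψ : B ≃* A` bicontinuous; two-sided Haar measures `ν′` on `B`, `ν = ψ_* ν′` on `A`; a conjugation-stable predicate `P` on `A`; a torus datum `T` on `A`, Haar ∕
inversion-invariant and conjugation-coherent on `P` (F0P3-p03's (W3-all) `T`, `P := Pall`); a predicate `Cen` of central elements of `B` off `P ∘ ψ` (the rational scalars `ζ•1 ⊗ 1`).
* §1 **`exists_centralizerMeasure_quotientMeasure_univ_eq_one`** — at a CENTRAL `b ∈ B` (`Z(b) = B`) the measure `ν′` itself, carried to `Z(b)`, is a Haar inversion-invariant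
  centraliser measure whose Weil quotient gives the one-point orbit space mass ONE (★ `quotientMeasure_centralizer_univ_mul_eq`): «`Φ(ζ, f) = f(ζ)`» [Prop. 10.1.2 (b)].
* §2 **`exists_isQuotientOf_of_coherent_torusDatum`** — for a predicate `Cen` of central elements of `B` that are not `P`-points through `ψ`, THERE IS a family `m′` on `B` and a
  datum `T′` with: (i) `m′` IS the Weil quotient of `ν′` by `T′` on the classes that are `P`-classes through `ψ` OR `Cen`-classes (★ `IsQuotientOf`); (ii) `m′` is `B`-invariant at
  every class; (iii) at every `Cen`-point `b`, `m′.atPoint b` has total mass `1`; (iv) at every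
  `P`-point `a` of `A`, the TRANSPORTED family reads `(ψ_* m′).atPoint a = dν ∕ dT_a` (★ (W4a) `IsQuotientOf.atPoint_transport_eq_quotientMeasure_of_pullback`) — the `hq` of ★
  (D5) ∕ ★ `archStableOrbitalIntegral_signed_eq_of_isArchInnerTransfer_of_pinned` at every wall torus point, for a family DEFINED on the inner form.  `T′` is the pull-back of `T`
  on the `P ∘ ψ`-points and §1's datum at the centre.

## References
* [Rogawski1990] J. D. Rogawski, *Automorphic Representations of Unitary Groups in Three Variables*, Ann. of Math. Stud. 123 (1990), §1.7 p. 6; §4.3 (4.3.1) p. 43; Prop. 10.1.2 (b)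
  p. 146; §14.5 pp. 237–239.
* [DeitmarEchterhoff2014] A. Deitmar, S. Echterhoff, *Principles of Harmonic Analysis*, 2nd ed. (2014), Thm. 1.5.3.
* [Folland1995] G. B. Folland, *A Course in Abstract Harmonic Analysis* (1995), §2.6 (2.52).
-/

set_option autoImplicit false

noncomputable section

open MeasureTheory Measure Set TopologicalSpace
open Literature.MeasureTheory.Group Literature.NumberTheory.Rogawski1990

namespace Literature.NumberTheory.Automorphic

/-! ## §1 The centre: `ν′` on `Z(b) = B` gives the one-point orbit space mass one -/

section Centre

variable {B : Type*} [Group B] [TopologicalSpace B] [IsTopologicalGroup B] [LocallyCompactSpace B] [SecondCountableTopology B]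
  [T2Space B] [MeasurableSpace B] [BorelSpace B]
  [∀ b : B, MeasurableSpace (B ⧸ Subgroup.centralizer ({b} : Set B))] [∀ b : B, BorelSpace (B ⧸ Subgroup.centralizer ({b} : Set B))]

/-- **AT A CENTRAL ELEMENT THE GROUP MEASURE ITSELF IS A CENTRALISER MEASURE WITH QUOTIENT MASS ONE.**  For `b` central in `B` (`Z(b) = B`) and a two-sided Haar measure `ν′` there is a
Haar, inversion-invariant measure `ρ` on `Z(b)` (namely `ν′` carried along `B ≃ Z(b)`) with `(dν′ ∕ dρ)(B ⧸ Z(b)) = 1` — Weil's formula on the one-point orbit space reads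
`(dν′∕dρ)(pt) · ρ(K) = ν′(K)` (★ `quotientMeasure_centralizer_univ_mul_eq`) and `ρ(K) = ν′(K)`. [cite: Rogawski1990, Prop. 10.1.2 (b) p. 146; §1.7 p. 6] [cite: DeitmarEchterhoff2014, Thm. 1.5.3] -/
theorem exists_centralizerMeasure_quotientMeasure_univ_eq_one (ν' : Measure B) [ν'.IsHaarMeasure] [ν'.IsMulRightInvariant]
    (b : B) (hb : ∀ g : B, g * b = b * g) :
    ∃ (ρ : Measure (Subgroup.centralizer ({b} : Set B))) (_ : ρ.IsHaarMeasure) (_ : ρ.IsInvInvariant),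
      quotientMeasure (Subgroup.centralizer ({b} : Set B)) ρ (isClosed_coe_centralizer_singleton b) ν' Set.univ = 1 := by
  have htop : Subgroup.centralizer ({b} : Set B) = ⊤ := centralizer_eq_top_of_forall_comm hb
  -- `B ≃ₜ* Z(b)`
  let e : B ≃* Subgroup.centralizer ({b} : Set B) := Subgroup.topEquiv.symm.trans (MulEquiv.subgroupCongr htop.symm)
  have hec : Continuous e := continuous_id.subtype_mk _
  have hesc : Continuous e.symm := continuous_subtype_val
  let ec : B ≃ₜ* Subgroup.centralizer ({b} : Set B) := { e with continuous_toFun := hec, continuous_invFun := hesc }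
  have hece : (⇑ec : B → Subgroup.centralizer ({b} : Set B)) = e := rfl
  haveI hZc : IsClosed ((Subgroup.centralizer ({b} : Set B) : Subgroup B) : Set B) := isClosed_coe_centralizer_singleton b
  haveI : LocallyCompactSpace (Subgroup.centralizer ({b} : Set B)) := hZc.isClosedEmbedding_subtypeVal.locallyCompactSpace
  -- the carried measure
  haveI h1 : (ν'.map e).IsHaarMeasure := MulEquiv.isHaarMeasure_map ν' e hec hesc
  haveI h2 : (ν'.map e).IsMulRightInvariant := hece ▸ UnitaryGroup.isMulRightInvariant_map_continuousMulEquiv ec ν'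
  haveI h3 : (ν'.map e).IsInvInvariant := isInvInvariant_of_isMulRightInvariant_of_isClosed _ hZc _
  refine ⟨ν'.map e, h1, h3, ?_⟩
  -- Weil's formula on the one-point orbit space, tested on a positive compact `K`
  obtain ⟨K⟩ : Nonempty (PositiveCompacts B) := inferInstance
  have hK0 : ν' (K : Set B) ≠ 0 := (measure_pos_of_nonempty_interior ν' K.interior_nonempty).ne'
  have hKtop : ν' (K : Set B) ≠ ⊤ := K.isCompact.measure_lt_top.ne
  have hW := quotientMeasure_centralizer_univ_mul_eq (γ := b) (fun g => by rw [hb g, mul_inv_cancel_right]) hZc (ν'.map e) ν'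
    K.isCompact.measurableSet
  have hρK : (ν'.map e) {h : Subgroup.centralizer ({b} : Set B) | (h : B) ∈ (K : Set B)} = ν' K := by
    change (ν'.map e) (Subtype.val ⁻¹' (K : Set B)) = _
    rw [Measure.map_apply hec.measurable (K.isCompact.measurableSet.preimage measurable_subtype_coe)]
    rfl
  rw [hρK, ← one_mul (ν' (K : Set B)), ← mul_assoc, mul_one] at hW
  exact (ENNReal.mul_left_inj hK0 hKtop).1 hW

end Centre

/-! ## §2 The Weil family of a coherent torus datum read through `ψ`, probability one-point orbit spaces at the centre -/

section Witness

variable {A B : Type*} [Group A] [Group B] [TopologicalSpace A] [TopologicalSpace B]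
  [IsTopologicalGroup A] [IsTopologicalGroup B] [LocallyCompactSpace A] [LocallyCompactSpace B]
  [SecondCountableTopology A] [SecondCountableTopology B] [T2Space A] [T2Space B]
  [MeasurableSpace A] [BorelSpace A] [MeasurableSpace B] [BorelSpace B]
  [∀ a : A, MeasurableSpace (A ⧸ Subgroup.centralizer ({a} : Set A))] [∀ a : A, BorelSpace (A ⧸ Subgroup.centralizer ({a} : Set A))]
  [∀ b : B, MeasurableSpace (B ⧸ Subgroup.centralizer ({b} : Set B))] [∀ b : B, BorelSpace (B ⧸ Subgroup.centralizer ({b} : Set B))]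
  (ψ : B ≃* A) (hψ : Continuous ψ) (hψs : Continuous ψ.symm)
  (ν' : Measure B) [ν'.IsHaarMeasure] [ν'.IsMulRightInvariant] (ν : Measure A) [ν.IsHaarMeasure] [ν.IsMulRightInvariant] (hν : ν = Measure.map ψ ν')
  {P : A → Prop} (hP : ∀ (a q : A), P a → P (q * a * q⁻¹))
  {Cen : B → Prop} (hCen : ∀ b : B, Cen b → ∀ g : B, g * b = b * g) (hCenP : ∀ b : B, Cen b → ¬ P (ψ b))
  (T : ∀ a : A, Measure (Subgroup.centralizer ({a} : Set A)))
  (hTi : ∀ a : A, P a → (T a).IsHaarMeasure ∧ (T a).IsInvInvariant)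
  (hcoh : ∀ (a₁ a₂ q : A) (hq : (MulAut.conj q : A ≃* A) a₁ = a₂), P a₁ →
    Measure.map (subgroupCongrHomeomorph (MulAut.conj q : A ≃* A) (Subgroup.centralizer ({a₁} : Set A)) (Subgroup.centralizer ({a₂} : Set A))
      (forall_apply_mem_centralizer_singleton_iff_of_eq (MulAut.conj q : A ≃* A) hq) (continuous_mulAutConj q) (continuous_mulAutConj_symm q)) (T a₁) = T a₂)

include hν hP hCen hCenP hTi hcoh in
/-- **THE WEIL FAMILY OF A COHERENT TORUS DATUM, READ THROUGH `ψ`, WITH PROBABILITY ONE-POINT ORBIT SPACES AT THE CENTRE.**  For `ψ : B ≃* A` bicontinuous, two-sided Haar measures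
`ν′` on `B` and `ν = ψ_* ν′` on `A`, a conjugation-stable predicate `P` on `A`, a predicate `Cen` of central elements of `B` that are not `P`-points through `ψ`, and a torus datum `T` on `A` that is Haar,
inversion-invariant and conjugation-coherent on `P`, THERE ARE a family `m′` on `B` and a datum `T′` such that: (i) `m′` IS the Weil quotient `dν′ ∕ dT′` on the classes of `B` that are `P`-classes
through `ψ` or `Cen` (★ `IsQuotientOf`); (ii) `m′` is `B`-invariant at every class; (iii) at every `Cen`-point `b` the one-point orbit space has `m′.atPoint b`-mass `1`
(«`Φ(ζ, f) = f(ζ)`», §1); (iv) at every `P`-point `a`, `(ψ_* m′).atPoint a = dν ∕ dT_a` (★ (W4a) §4) — the singular `hq` of ★ (D5) ∕ ★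
`archStableOrbitalIntegral_signed_eq_of_isArchInnerTransfer_of_pinned` for the family DEFINED on the source carrier.  (`T′` = pull-back of `T` on `P ∘ ψ`, §1's datum at the centre.)
[cite: Rogawski1990, §1.7 p. 6; §4.3 (4.3.1) p. 43; Prop. 10.1.2 (b) p. 146; §14.5 pp. 238–239] [cite: DeitmarEchterhoff2014, Thm. 1.5.3] -/
theorem exists_isQuotientOf_of_coherent_torusDatum :
    ∃ (m' : OrbitalMeasureFamily B) (T' : ∀ b : B, Measure (Subgroup.centralizer ({b} : Set B))),
      m'.IsQuotientOf (fun b => P (ψ b) ∨ Cen b) ν' T' ∧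
      (∀ c : ConjClasses B, SMulInvariantMeasure B (B ⧸ Subgroup.centralizer ({(Quotient.out c : B)} : Set B)) (m' c)) ∧
      (∀ b : B, Cen b → m'.atPoint b Set.univ = 1) ∧
      (∀ a : A, P a → ∃ (_ : (T a).IsHaarMeasure) (_ : (T a).IsInvInvariant),
        (m'.transport ψ hψ hψs).atPoint a = quotientMeasure (Subgroup.centralizer ({a} : Set A)) (T a) (isClosed_coe_centralizer_singleton a) ν) := by
  classical
  -- §1's central data
  have hcen : ∀ b : B, (∀ g : B, g * b = b * g) → ∃ (ρ : Measure (Subgroup.centralizer ({b} : Set B))) (_ : ρ.IsHaarMeasure) (_ : ρ.IsInvInvariant),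
      quotientMeasure (Subgroup.centralizer ({b} : Set B)) ρ (isClosed_coe_centralizer_singleton b) ν' Set.univ = 1 :=
    fun b hb => exists_centralizerMeasure_quotientMeasure_univ_eq_one ν' b hb
  -- the datum: pull-back of `T` through `ψ` on the `P ∘ ψ`-points, §1's datum at the centre, junk `0` elsewhere
  let T' : ∀ b : B, Measure (Subgroup.centralizer ({b} : Set B)) := fun b =>
    if P (ψ b) then
      (T (ψ b)).map (subgroupCongrHomeomorph ψ.symm (Subgroup.centralizer ({ψ b} : Set A)) (Subgroup.centralizer ({b} : Set B))
        (forall_apply_mem_centralizer_singleton_iff_of_eq ψ.symm (ψ.symm_apply_apply b)) hψs hψ)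
    else if hb : Cen b then (hcen b (hCen b hb)).choose else 0
  have hT'w : ∀ b : B, P (ψ b) → T' b =
      (T (ψ b)).map (subgroupCongrHomeomorph ψ.symm (Subgroup.centralizer ({ψ b} : Set A)) (Subgroup.centralizer ({b} : Set B))
        (forall_apply_mem_centralizer_singleton_iff_of_eq ψ.symm (ψ.symm_apply_apply b)) hψs hψ) := fun b h => by
    simp only [T', if_pos h]
  have hT'c : ∀ (b : B) (hb : Cen b), ¬ P (ψ b) → T' b = (hcen b (hCen b hb)).choose := fun b hb h => by
    simp only [T', if_neg h, dif_pos hb]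
  -- the datum is Haar ∕ inversion-invariant at the guarded points
  have hT'i : ∀ b : B, (P (ψ b) ∨ Cen b) → (T' b).IsHaarMeasure ∧ (T' b).IsInvInvariant := by
    intro b h
    by_cases hw : P (ψ b)
    · rw [hT'w b hw]
      haveI := (hTi _ hw).1
      haveI := (hTi _ hw).2
      exact ⟨isHaarMeasure_pullback ψ hψ hψs T b, isInvInvariant_pullback ψ hψ hψs T b⟩
    · have hb : Cen b := h.resolve_left hw
      rw [hT'c b hb hw]
      exact ⟨(hcen b (hCen b hb)).choose_spec.choose, (hcen b (hCen b hb)).choose_spec.choose_spec.choose⟩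
  -- the family (★ (W4a) §1)
  obtain ⟨m', hm', hinv, -⟩ := exists_orbitalMeasureFamily_isQuotientOf (fun b => P (ψ b) ∨ Cen b) ν' T' hT'i
  refine ⟨m', T', hm', hinv, fun b hb => ?_, fun a ha => ?_⟩
  · -- (iii) the centre: `m′.atPoint b (univ) = m′ ⟦b⟧ (univ) = (dν′ ∕ dT′_{out ⟦b⟧})(pt) = 1`
    have hout : (Quotient.out (ConjClasses.mk b) : B) = b := quotientOut_conjClassesMk_eq_of_forall_comm (hCen b hb)
    have h1 : m'.atPoint b Set.univ = m' (ConjClasses.mk b) Set.univ := by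
      rw [OrbitalMeasureFamily.atPoint, Measure.map_apply (continuous_cosetCongr _ _ _ _ (continuous_mulAutConj _)).measurable MeasurableSet.univ,
        Set.preimage_univ]
    rw [h1]
    have hbo : Cen (Quotient.out (ConjClasses.mk b) : B) := by
      rw [hout]; exact hb
    obtain ⟨i1, i2, hq⟩ := hm' (ConjClasses.mk b) (Or.inr hbo)
    rw [hq]
    have hTc := hT'c _ hbo (hCenP _ hbo)
    have key : ∀ (ρ : Measure (Subgroup.centralizer ({(Quotient.out (ConjClasses.mk b) : B)} : Set B))) (_ : ρ.IsHaarMeasure) (_ : ρ.IsInvInvariant),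
        T' (Quotient.out (ConjClasses.mk b)) = ρ →
          quotientMeasure (Subgroup.centralizer ({(Quotient.out (ConjClasses.mk b) : B)} : Set B)) (T' (Quotient.out (ConjClasses.mk b)))
              (isClosed_coe_centralizer_singleton _) ν' =
            quotientMeasure (Subgroup.centralizer ({(Quotient.out (ConjClasses.mk b) : B)} : Set B)) ρ (isClosed_coe_centralizer_singleton _) ν' := by
      intro ρ _ _ h
      subst h
      rfl
    rw [key _ (hcen _ (hCen _ hbo)).choose_spec.choose (hcen _ (hCen _ hbo)).choose_spec.choose_spec.choose hTc]
    exact (hcen _ (hCen _ hbo)).choose_spec.choose_spec.choose_spec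
  · -- (iv) the wall points: ★ (W4a) §4 for `m′` restricted to `P ∘ ψ` with the pull-back datum
    have hmw : m'.IsQuotientOf (fun b => P (ψ b)) ν' (fun b => (T (ψ b)).map (subgroupCongrHomeomorph ψ.symm (Subgroup.centralizer ({ψ b} : Set A))
        (Subgroup.centralizer ({b} : Set B)) (forall_apply_mem_centralizer_singleton_iff_of_eq ψ.symm (ψ.symm_apply_apply b)) hψs hψ)) :=
      hm'.of_imp_of_eq (fun c hc => Or.inl hc) (fun c hc => (hT'w _ hc).symm)
    exact hmw.atPoint_transport_eq_quotientMeasure_of_pullback ψ hψ hψs hP ν' ν hν T hcoh a ha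

end Witness

end Literature.NumberTheory.Automorphic

end
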